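/-
Origin: written from primary sources — A. Weil, *Sur certains groupes d'opérateurs unitaires*, Acta Math. 111 (1964) Chap. III
n° 41, Théorème 6 p. 193 (invariance of `Θ` under the rational points); S. Gelbart, J. Rogawski, Invent. Math. 105 (1991) §3.1
Prop. 3.1.1 p. 455, Remark p. 457 L4–13 (a splitting normalised by a character trivial on the rational points has the same theta
series there); V. Platonov, A. Rapinchuk, *Algebraic groups and number theory* (1994) §6.2 (rational points of the norm-one
torus); C.-P. Mok, Mem. AMS 235 (2014) §1 Notation p. 5 (the centre of `U(N)` is `U(1)`). Adapted: no. This file carries the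
rational `Θ`-invariance of `UnitaryDualPairSeesawCMLines` §5 / `…SeesawCMLinesConj` §5 (the RAW line representations on
`U(diag dV)(L⁺) × U(⟨x⟩)(L⁺)`) to the TWISTED line representations `cmLineRep_k η_k`, `cmConjLineRep_k η_k` on
`U(diag dV) × U(1)` and to their `Fin`/`ker N_{L/L⁺}` currency `cmLineRepFin_k η_k`, `cmConjLineRepFin_k η_k`, through the
rationality of the centre (`UnitaryGroupAdelicCenterRational`). Kernel only; no records; nothing cited as a hypothesis.
-/
import Literature.NumberTheory.GelbartRogawski1991.UnitaryDualPairSeesawCMLinesConj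
import Literature.NumberTheory.Automorphic.UnitaryGroupAdelicCenterRational
import HarnessLib

-- buildfix G11b-3 recipe (LEDGER B13-1/B13-3): elaborate sequentially so the trailing `attribute [implicit_reducible]`
-- block (reducibilityCoreExt is keyed to the async environment branch) is in force at `.olean` export.
set_option Elab.async false

/-!
# `Θ`-invariance at the rational points for the twisted CM line representations (`theta_rat` of the period packet's lines)

Setting of `UnitaryDualPairSeesawCMLines` / `…SeesawCMLinesConj`: CM field `L` (`L⁺ = maximalRealSubfield L`), `V = diag(dV)`,
the plane `W = diag(a₀,a₁)` with its chosen compatible splitting `splittingOf hGR`, the lines `⟨a_k⟩` (resp. `⟨b_k⟩` of a second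
plane `diag(b) = ᵗḡ₀ · diag(a) · g₀`) with `splittingOf hGR_k` ([GelbartRogawski1991, Prop. 3.1.1]), and the line representations
`cmLineRepRaw_k = ω_k″`, `cmLineRep_k η_k = η_k • (ω_k″ ∘ (id × centre))` on `U(V)(𝔸) × U(1)(𝔸)`, `cmLineRepFin_k η_k` on
`U(V)(𝔸) × ker N_{L/L⁺}` acting on `𝒮(𝔸^{n₁})` (and the `Conj` versions).  [Weil1964, Thm 6] for the RAW representations at
rational `(γ_U, γ) ∈ U(V)(L⁺) × U(⟨x⟩)(L⁺)` is `cmLineRepRaw₀/₁_toHomUnits_mem_thetaStabilizer` /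
`cmConjLineRepRaw₀/₁_toHomUnits_mem_thetaStabilizer` (LAYER A / A″ §5).  This file adds:

* §1 **`cmLineRep₀/₁_mem_thetaStabilizerEnd`**: `cmLineRep_k η_k (γ_U, u) ∈ thetaStabilizerEnd` for `γ_U ∈ U(V)(L⁺)`, `u ∈ U(1)(𝔸)`
  with `u · 1 ∈ U(⟨a_k⟩)(L⁺)` and `η_k(γ_U, u) = 1` (the twist is invisible where the character is trivial —
  [GelbartRogawski1991, Remark p. 457]); **`cmLineRepFin₀/₁_mem_thetaStabilizerEnd`**: `cmLineRepFin_k η_k (γ_U, t) ∈ thetaStabilizerEnd`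
  for `γ_U ∈ U(V)(L⁺)` and `t ∈ U(1)_{L/L⁺}(L⁺)` (`relNormOneRat`: principal idèles of relative norm one), provided `η_k` is trivial
  at `(γ_U, t)` — the centre carries principal norm-one idèles to rational points (`UnitaryGroup.cm_adelicCenter_symm_mem_range_toAdelic`,
  [Mok2014, §1; PlatonovRapinchuk1994, §6.2]) and `R_{e₁}` fixes `Θ` (`thetaDistLM_piSBReindex`);
* §2 the same four statements for `cmConjLineRep₀/₁`, `cmConjLineRepFin₀/₁` (second plane, `g = g₀ ⊗ 1`);
* §3 the quantified forms **`forall_cmLineRepFin₀/₁_mem_thetaStabilizerEnd`**, **`forall_cmConjLineRepFin₀/₁_mem_thetaStabilizerEnd`**: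
  under `hη_k : ∀ γ_U ∈ U(V)(L⁺), ∀ t ∈ relNormOneRat, η_k (γ_U, t♭) = 1` (the S-term's η-split is trivial on rational points),
  `∀ γ_U ∈ U(V)(L⁺), ∀ t ∈ relNormOneRat, cmLineRepFin_k η_k (γ_U, t) ∈ thetaStabilizerEnd` — literally the shape of the field
  `WeilPairData.theta_rat` of the Hodge-CM period packet's line data.

Provenance / use (Hodge-CM model-construction cell, BINDER-OWNERS rows `real34` / `S`): with `UnitaryDualPairSeesawCMLines{,Conj}Majorants`
(the `majorants` field) this is the tree supply for the `theta_rat` field of theta-3's `restrictTwist (lineRepOf k)`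
(`HodgeCM/Model/ArchSideTerm.lean`; rational points of the regime subgroup map into `U(diag dV)(L⁺)` by the package's
`cmFrameEquiv_mem_range_toAdelic`). Nothing here is a claim of the manuscripts under adjudication: kernel analysis over the
tree's constructed objects.
-/

set_option autoImplicit false

noncomputable section

open scoped Matrix Kronecker
open NumberField
open Literature.RepresentationTheory Literature.RepresentationTheory.SeesawScalar
open Literature.NumberTheory.Automorphic
open Literature.NumberTheory.Automorphic.UnitaryGroup
open Literature.NumberTheory.Weil1964

namespace Literature.NumberTheory.GelbartRogawski1991

namespace UnitaryDualPair

/-! ## §1 The plane `diag(a₀, a₁)` (`g = 1`) -/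

section Plane

variable (L : Type) [Field L] [NumberField L] [IsCMField L] {N n n₁ : ℕ}
  (e : Fin N × Fin 2 ≃ Fin n) (e₁ : Fin N × Fin 1 ≃ Fin n₁)
variable (dV : Fin N → L) (hdV : ∀ i, IsCMField.complexConj L (dV i) = dV i) (hdV0 : ∀ i, dV i ≠ 0)
variable (a : Fin 2 → L) (ha : ∀ i, IsCMField.complexConj L (a i) = a i) (ha0 : ∀ i, a i ≠ 0)
variable (hGR : (cmSplittingDatum L e dV hdV hdV0 a ha ha0).CompatibleSplitting)
  (hGR₀ : (cmSplittingDatum L e₁ dV hdV hdV0 (lineVec L (a 0)) (fun _ => ha 0) (fun _ => ha0 0)).CompatibleSplitting)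
  (hGR₁ : (cmSplittingDatum L e₁ dV hdV hdV0 (lineVec L (a 1)) (fun _ => ha 1) (fun _ => ha0 1)).CompatibleSplitting)
  (η₀ η₁ : CMAdelic L dV × CMAdelicOne L →* ℂˣ)

/-- **`cmLineRep₀ η₀ (γ_U, u)` fixes `Θ`** for `γ_U ∈ U(diag dV)(L⁺)`, `u ∈ U(1)(𝔸)` with `u · 1 ∈ U(⟨a₀⟩)(L⁺)` and `η₀(γ_U, u) = 1`.
[cite: Weil1964, Chap. III n° 41 Thm 6 p. 193; GelbartRogawski1991, §3.1 Remark p. 457 L4–13] -/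
theorem cmLineRep₀_mem_thetaStabilizerEnd {v : CMAdelic L dV} (hv : v ∈ CMRat L dV) {u : CMAdelicOne L}
    (hu : CMCenter L (lineVec L (a 0)) u ∈ CMRat L (lineVec L (a 0))) (hη : η₀ (v, u) = 1) :
    cmLineRep₀ L e e₁ dV hdV hdV0 a ha ha0 hGR hGR₀ hGR₁ η₀ (v, u) ∈
      thetaStabilizerEnd (↥(maximalRealSubfield L)) (Fin N × Fin 1) := fun Φ => by
  rw [cmLineRep₀_apply, hη, Units.val_one, one_smul]
  exact (mem_thetaStabilizer_iff _).1
    (cmLineRepRaw₀_toHomUnits_mem_thetaStabilizer L e e₁ dV hdV hdV0 a ha ha0 hGR hGR₀ hGR₁ hv hu) Φ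

/-- **`cmLineRep₁ η₁ (γ_U, u)` fixes `Θ`** for `γ_U ∈ U(diag dV)(L⁺)`, `u · 1 ∈ U(⟨a₁⟩)(L⁺)` and `η₁(γ_U, u) = 1`.
[cite: Weil1964, Chap. III n° 41 Thm 6 p. 193; GelbartRogawski1991, §3.1 Remark p. 457 L4–13] -/
theorem cmLineRep₁_mem_thetaStabilizerEnd {v : CMAdelic L dV} (hv : v ∈ CMRat L dV) {u : CMAdelicOne L}
    (hu : CMCenter L (lineVec L (a 1)) u ∈ CMRat L (lineVec L (a 1))) (hη : η₁ (v, u) = 1) :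
    cmLineRep₁ L e e₁ dV hdV hdV0 a ha ha0 hGR hGR₀ hGR₁ η₁ (v, u) ∈
      thetaStabilizerEnd (↥(maximalRealSubfield L)) (Fin N × Fin 1) := fun Φ => by
  rw [cmLineRep₁_apply, hη, Units.val_one, one_smul]
  exact (mem_thetaStabilizer_iff _).1
    (cmLineRepRaw₁_toHomUnits_mem_thetaStabilizer L e e₁ dV hdV hdV0 a ha ha0 hGR hGR₀ hGR₁ hv hu) Φ

/-- **`cmLineRepFin₀ η₀ (γ_U, t)` fixes `Θ`** for `γ_U ∈ U(diag dV)(L⁺)` and `t ∈ U(1)_{L/L⁺}(L⁺)` (a principal norm-one idèle),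
provided `η₀(γ_U, t♭) = 1` (`t♭ = (cmAdelicOneEquivRelNormOne L)⁻¹ t`): the centre carries `t♭` to a rational point of `U(⟨a₀⟩)`,
and `R_{e₁}` fixes `Θ`. [cite: Weil1964, Chap. III n° 41 Thm 6 p. 193; Mok2014, §1 Notation p. 5; PlatonovRapinchuk1994, §6.2] -/
theorem cmLineRepFin₀_mem_thetaStabilizerEnd {v : CMAdelic L dV} (hv : v ∈ CMRat L dV)
    {t : ↥(relNormOneIdeles (↥(maximalRealSubfield L)) L)} (ht : t ∈ relNormOneRat (↥(maximalRealSubfield L)) L)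
    (hη : η₀ (v, (cmAdelicOneEquivRelNormOne L).symm t) = 1) :
    cmLineRepFin₀ L e e₁ dV hdV hdV0 a ha ha0 hGR hGR₀ hGR₁ η₀ (v, t) ∈
      thetaStabilizerEnd (↥(maximalRealSubfield L)) (Fin n₁) := fun φ => by
  rw [cmLineRepFin₀_apply, thetaDistLM_piSBReindex,
    cmLineRep₀_mem_thetaStabilizerEnd L e e₁ dV hdV hdV0 a ha ha0 hGR hGR₀ hGR₁ η₀ hv
      (cm_adelicCenter_symm_mem_range_toAdelic L 1 (Matrix.diagonal (lineVec L (a 0))) t ht) hη,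
    piSBReindex_symm, thetaDistLM_piSBReindex]

/-- **`cmLineRepFin₁ η₁ (γ_U, t)` fixes `Θ`** for `γ_U ∈ U(diag dV)(L⁺)`, `t ∈ U(1)_{L/L⁺}(L⁺)`, `η₁(γ_U, t♭) = 1`.
[cite: Weil1964, Chap. III n° 41 Thm 6 p. 193; Mok2014, §1 Notation p. 5; PlatonovRapinchuk1994, §6.2] -/
theorem cmLineRepFin₁_mem_thetaStabilizerEnd {v : CMAdelic L dV} (hv : v ∈ CMRat L dV)
    {t : ↥(relNormOneIdeles (↥(maximalRealSubfield L)) L)} (ht : t ∈ relNormOneRat (↥(maximalRealSubfield L)) L)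
    (hη : η₁ (v, (cmAdelicOneEquivRelNormOne L).symm t) = 1) :
    cmLineRepFin₁ L e e₁ dV hdV hdV0 a ha ha0 hGR hGR₀ hGR₁ η₁ (v, t) ∈
      thetaStabilizerEnd (↥(maximalRealSubfield L)) (Fin n₁) := fun φ => by
  rw [cmLineRepFin₁_apply, thetaDistLM_piSBReindex,
    cmLineRep₁_mem_thetaStabilizerEnd L e e₁ dV hdV hdV0 a ha ha0 hGR hGR₀ hGR₁ η₁ hv
      (cm_adelicCenter_symm_mem_range_toAdelic L 1 (Matrix.diagonal (lineVec L (a 1))) t ht) hη,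
    piSBReindex_symm, thetaDistLM_piSBReindex]

/-- **`theta_rat` for `cmLineRepFin₀ η₀`** — the quantified form: if the twisting character `η₀` is trivial at every rational
point `(γ_U, t♭)`, then `cmLineRepFin₀ η₀ (γ_U, t)` fixes `Θ` for all `γ_U ∈ U(diag dV)(L⁺)`, `t ∈ U(1)_{L/L⁺}(L⁺)` (the field
`theta_rat` of the Hodge-CM period packet's line data, line `k = 0`).
[cite: Weil1964, Chap. III n° 41 Thm 6 p. 193; GelbartRogawski1991, §3.1 Remark p. 457 L4–13] -/
theorem forall_cmLineRepFin₀_mem_thetaStabilizerEnd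
    (hη₀ : ∀ v ∈ CMRat L dV, ∀ t ∈ relNormOneRat (↥(maximalRealSubfield L)) L,
      η₀ (v, (cmAdelicOneEquivRelNormOne L).symm t) = 1) :
    ∀ v ∈ CMRat L dV, ∀ t ∈ relNormOneRat (↥(maximalRealSubfield L)) L,
      cmLineRepFin₀ L e e₁ dV hdV hdV0 a ha ha0 hGR hGR₀ hGR₁ η₀ (v, t) ∈
        thetaStabilizerEnd (↥(maximalRealSubfield L)) (Fin n₁) :=
  fun _ hv _ ht => cmLineRepFin₀_mem_thetaStabilizerEnd L e e₁ dV hdV hdV0 a ha ha0 hGR hGR₀ hGR₁ η₀ hv ht (hη₀ _ hv _ ht)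

/-- **`theta_rat` for `cmLineRepFin₁ η₁`** (line `k = 1`). [cite: Weil1964, Chap. III n° 41 Thm 6 p. 193; GelbartRogawski1991, §3.1 Remark p. 457 L4–13] -/
theorem forall_cmLineRepFin₁_mem_thetaStabilizerEnd
    (hη₁ : ∀ v ∈ CMRat L dV, ∀ t ∈ relNormOneRat (↥(maximalRealSubfield L)) L,
      η₁ (v, (cmAdelicOneEquivRelNormOne L).symm t) = 1) :
    ∀ v ∈ CMRat L dV, ∀ t ∈ relNormOneRat (↥(maximalRealSubfield L)) L,
      cmLineRepFin₁ L e e₁ dV hdV hdV0 a ha ha0 hGR hGR₀ hGR₁ η₁ (v, t) ∈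
        thetaStabilizerEnd (↥(maximalRealSubfield L)) (Fin n₁) :=
  fun _ hv _ ht => cmLineRepFin₁_mem_thetaStabilizerEnd L e e₁ dV hdV hdV0 a ha ha0 hGR hGR₀ hGR₁ η₁ hv ht (hη₁ _ hv _ ht)

end Plane

/-! ## §2 The conjugated plane `diag(b₀, b₁)` (`g = g₀ ⊗ 1`) -/

section ConjPlane

variable (L : Type) [Field L] [NumberField L] [IsCMField L] {N n n₁ : ℕ}
  (e : Fin N × Fin 2 ≃ Fin n) (e₁ : Fin N × Fin 1 ≃ Fin n₁)
variable (dV : Fin N → L) (hdV : ∀ i, IsCMField.complexConj L (dV i) = dV i) (hdV0 : ∀ i, dV i ≠ 0)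
variable (a : Fin 2 → L) (ha : ∀ i, IsCMField.complexConj L (a i) = a i) (ha0 : ∀ i, a i ≠ 0)
variable (b : Fin 2 → L) (hb : ∀ i, IsCMField.complexConj L (b i) = b i) (hb0 : ∀ i, b i ≠ 0) (g₀ : GL (Fin 2) L)
  (hg₀ : ((g₀ : Matrix (Fin 2) (Fin 2) L).map (IsCMField.complexConj L : L →+* L))ᵀ * Matrix.diagonal a *
    (g₀ : Matrix (Fin 2) (Fin 2) L) = Matrix.diagonal b)
variable (hGR : (cmSplittingDatum L e dV hdV hdV0 a ha ha0).CompatibleSplitting)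
  (hGR₀ : (cmSplittingDatum L e₁ dV hdV hdV0 (lineVec L (b 0)) (fun _ => hb 0) (fun _ => hb0 0)).CompatibleSplitting)
  (hGR₁ : (cmSplittingDatum L e₁ dV hdV hdV0 (lineVec L (b 1)) (fun _ => hb 1) (fun _ => hb0 1)).CompatibleSplitting)
  (η₀ η₁ : CMAdelic L dV × CMAdelicOne L →* ℂˣ)

/-- **`cmConjLineRep₀ η₀ (γ_U, u)` fixes `Θ`** for `γ_U ∈ U(diag dV)(L⁺)`, `u · 1 ∈ U(⟨b₀⟩)(L⁺)` and `η₀(γ_U, u) = 1`.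
[cite: Weil1964, Chap. III n° 41 Thm 6 p. 193; GelbartRogawski1991, §3.1 Remark p. 457 L4–13] -/
theorem cmConjLineRep₀_mem_thetaStabilizerEnd {v : CMAdelic L dV} (hv : v ∈ CMRat L dV) {u : CMAdelicOne L}
    (hu : CMCenter L (lineVec L (b 0)) u ∈ CMRat L (lineVec L (b 0))) (hη : η₀ (v, u) = 1) :
    cmConjLineRep₀ L e e₁ dV hdV hdV0 a ha ha0 b hb hb0 g₀ hg₀ hGR hGR₀ hGR₁ η₀ (v, u) ∈
      thetaStabilizerEnd (↥(maximalRealSubfield L)) (Fin N × Fin 1) := fun Φ => by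
  rw [cmConjLineRep₀_apply, hη, Units.val_one, one_smul]
  exact (mem_thetaStabilizer_iff _).1
    (cmConjLineRepRaw₀_toHomUnits_mem_thetaStabilizer L e e₁ dV hdV hdV0 a ha ha0 b hb hb0 g₀ hg₀ hGR hGR₀ hGR₁ hv hu) Φ

/-- **`cmConjLineRep₁ η₁ (γ_U, u)` fixes `Θ`** for `γ_U ∈ U(diag dV)(L⁺)`, `u · 1 ∈ U(⟨b₁⟩)(L⁺)` and `η₁(γ_U, u) = 1`.
[cite: Weil1964, Chap. III n° 41 Thm 6 p. 193; GelbartRogawski1991, §3.1 Remark p. 457 L4–13] -/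
theorem cmConjLineRep₁_mem_thetaStabilizerEnd {v : CMAdelic L dV} (hv : v ∈ CMRat L dV) {u : CMAdelicOne L}
    (hu : CMCenter L (lineVec L (b 1)) u ∈ CMRat L (lineVec L (b 1))) (hη : η₁ (v, u) = 1) :
    cmConjLineRep₁ L e e₁ dV hdV hdV0 a ha ha0 b hb hb0 g₀ hg₀ hGR hGR₀ hGR₁ η₁ (v, u) ∈
      thetaStabilizerEnd (↥(maximalRealSubfield L)) (Fin N × Fin 1) := fun Φ => by
  rw [cmConjLineRep₁_apply, hη, Units.val_one, one_smul]
  exact (mem_thetaStabilizer_iff _).1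
    (cmConjLineRepRaw₁_toHomUnits_mem_thetaStabilizer L e e₁ dV hdV hdV0 a ha ha0 b hb hb0 g₀ hg₀ hGR hGR₀ hGR₁ hv hu) Φ

/-- **`cmConjLineRepFin₀ η₀ (γ_U, t)` fixes `Θ`** for `γ_U ∈ U(diag dV)(L⁺)`, `t ∈ U(1)_{L/L⁺}(L⁺)`, `η₀(γ_U, t♭) = 1`.
[cite: Weil1964, Chap. III n° 41 Thm 6 p. 193; Mok2014, §1 Notation p. 5; PlatonovRapinchuk1994, §6.2] -/
theorem cmConjLineRepFin₀_mem_thetaStabilizerEnd {v : CMAdelic L dV} (hv : v ∈ CMRat L dV)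
    {t : ↥(relNormOneIdeles (↥(maximalRealSubfield L)) L)} (ht : t ∈ relNormOneRat (↥(maximalRealSubfield L)) L)
    (hη : η₀ (v, (cmAdelicOneEquivRelNormOne L).symm t) = 1) :
    cmConjLineRepFin₀ L e e₁ dV hdV hdV0 a ha ha0 b hb hb0 g₀ hg₀ hGR hGR₀ hGR₁ η₀ (v, t) ∈
      thetaStabilizerEnd (↥(maximalRealSubfield L)) (Fin n₁) := fun φ => by
  rw [cmConjLineRepFin₀_apply, thetaDistLM_piSBReindex,
    cmConjLineRep₀_mem_thetaStabilizerEnd L e e₁ dV hdV hdV0 a ha ha0 b hb hb0 g₀ hg₀ hGR hGR₀ hGR₁ η₀ hv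
      (cm_adelicCenter_symm_mem_range_toAdelic L 1 (Matrix.diagonal (lineVec L (b 0))) t ht) hη,
    piSBReindex_symm, thetaDistLM_piSBReindex]

/-- **`cmConjLineRepFin₁ η₁ (γ_U, t)` fixes `Θ`** for `γ_U ∈ U(diag dV)(L⁺)`, `t ∈ U(1)_{L/L⁺}(L⁺)`, `η₁(γ_U, t♭) = 1`.
[cite: Weil1964, Chap. III n° 41 Thm 6 p. 193; Mok2014, §1 Notation p. 5; PlatonovRapinchuk1994, §6.2] -/
theorem cmConjLineRepFin₁_mem_thetaStabilizerEnd {v : CMAdelic L dV} (hv : v ∈ CMRat L dV)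
    {t : ↥(relNormOneIdeles (↥(maximalRealSubfield L)) L)} (ht : t ∈ relNormOneRat (↥(maximalRealSubfield L)) L)
    (hη : η₁ (v, (cmAdelicOneEquivRelNormOne L).symm t) = 1) :
    cmConjLineRepFin₁ L e e₁ dV hdV hdV0 a ha ha0 b hb hb0 g₀ hg₀ hGR hGR₀ hGR₁ η₁ (v, t) ∈
      thetaStabilizerEnd (↥(maximalRealSubfield L)) (Fin n₁) := fun φ => by
  rw [cmConjLineRepFin₁_apply, thetaDistLM_piSBReindex,
    cmConjLineRep₁_mem_thetaStabilizerEnd L e e₁ dV hdV hdV0 a ha ha0 b hb hb0 g₀ hg₀ hGR hGR₀ hGR₁ η₁ hv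
      (cm_adelicCenter_symm_mem_range_toAdelic L 1 (Matrix.diagonal (lineVec L (b 1))) t ht) hη,
    piSBReindex_symm, thetaDistLM_piSBReindex]

/-- **`theta_rat` for `cmConjLineRepFin₀ η₀`** (line `k = 2` of the period packet), quantified form.
[cite: Weil1964, Chap. III n° 41 Thm 6 p. 193; GelbartRogawski1991, §3.1 Remark p. 457 L4–13] -/
theorem forall_cmConjLineRepFin₀_mem_thetaStabilizerEnd
    (hη₀ : ∀ v ∈ CMRat L dV, ∀ t ∈ relNormOneRat (↥(maximalRealSubfield L)) L,
      η₀ (v, (cmAdelicOneEquivRelNormOne L).symm t) = 1) :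
    ∀ v ∈ CMRat L dV, ∀ t ∈ relNormOneRat (↥(maximalRealSubfield L)) L,
      cmConjLineRepFin₀ L e e₁ dV hdV hdV0 a ha ha0 b hb hb0 g₀ hg₀ hGR hGR₀ hGR₁ η₀ (v, t) ∈
        thetaStabilizerEnd (↥(maximalRealSubfield L)) (Fin n₁) :=
  fun _ hv _ ht => cmConjLineRepFin₀_mem_thetaStabilizerEnd L e e₁ dV hdV hdV0 a ha ha0 b hb hb0 g₀ hg₀ hGR hGR₀ hGR₁ η₀ hv ht
    (hη₀ _ hv _ ht)

/-- **`theta_rat` for `cmConjLineRepFin₁ η₁`** (line `k = 3`), quantified form.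
[cite: Weil1964, Chap. III n° 41 Thm 6 p. 193; GelbartRogawski1991, §3.1 Remark p. 457 L4–13] -/
theorem forall_cmConjLineRepFin₁_mem_thetaStabilizerEnd
    (hη₁ : ∀ v ∈ CMRat L dV, ∀ t ∈ relNormOneRat (↥(maximalRealSubfield L)) L,
      η₁ (v, (cmAdelicOneEquivRelNormOne L).symm t) = 1) :
    ∀ v ∈ CMRat L dV, ∀ t ∈ relNormOneRat (↥(maximalRealSubfield L)) L,
      cmConjLineRepFin₁ L e e₁ dV hdV hdV0 a ha ha0 b hb hb0 g₀ hg₀ hGR hGR₀ hGR₁ η₁ (v, t) ∈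
        thetaStabilizerEnd (↥(maximalRealSubfield L)) (Fin n₁) :=
  fun _ hv _ ht => cmConjLineRepFin₁_mem_thetaStabilizerEnd L e e₁ dV hdV hdV0 a ha ha0 b hb hb0 g₀ hg₀ hGR hGR₀ hGR₁ η₁ hv ht
    (hη₁ _ hv _ ht)

end ConjPlane

/-! ## §3 Rational points of the two tori and the DEFAULT η-split (`η₀ := cmEta₀ η`, `η₁ := cmEta₁ η ∘ snd`) -/

section DefaultSplit

variable (L : Type) [Field L] [NumberField L] [IsCMField L] {N : ℕ} (dV : Fin N → L) (a b : Fin 2 → L) (g₀ : GL (Fin 2) L)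
  (hg₀ : ((g₀ : Matrix (Fin 2) (Fin 2) L).map (IsCMField.complexConj L : L →+* L))ᵀ * Matrix.diagonal a *
    (g₀ : Matrix (Fin 2) (Fin 2) L) = Matrix.diagonal b)

/-- **principal norm-one idèles give RATIONAL points of the plane's diagonal torus**: `diag(t₀, t₁) ∈ U(diag(a₀,a₁))(L⁺)` for
`t₀, t₁ ∈ U(1)_{L/L⁺}(L⁺)` (centre of each line is rational, p. `UnitaryGroupAdelicCenterRational`; block-diagonal of rational points is
rational, `adelicBlockDiag_toAdelic_mem_range`; `g = 1`). [cite: Mok2014, §1 Notation p. 5; PlatonovRapinchuk1994, §6.2] -/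
theorem cmPlaneTorusIdeles_mem_CMRat {t₀ t₁ : ↥(relNormOneIdeles (↥(maximalRealSubfield L)) L)}
    (ht₀ : t₀ ∈ relNormOneRat (↥(maximalRealSubfield L)) L) (ht₁ : t₁ ∈ relNormOneRat (↥(maximalRealSubfield L)) L) :
    cmPlaneTorusIdeles L a (t₀, t₁) ∈ CMRat L a := by
  obtain ⟨γ₀, h₀⟩ := cm_adelicCenter_symm_mem_range_toAdelic L 1 (Matrix.diagonal (lineVec L (a 0))) t₀ ht₀
  obtain ⟨γ₁, h₁⟩ := cm_adelicCenter_symm_mem_range_toAdelic L 1 (Matrix.diagonal (lineVec L (a 1))) t₁ ht₁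
  show adelicIsometryConj (↥(maximalRealSubfield L)) L (IsCMField.complexConj L) (1 + 1) 1 (adelicIsometry_one_lineVec L a)
      (adelicBlockDiag (↥(maximalRealSubfield L)) L (IsCMField.complexConj L) 1 1 (Matrix.diagonal (lineVec L (a 0)))
        (Matrix.diagonal (lineVec L (a 1)))
        (CMCenter L (lineVec L (a 0)) ((cmAdelicOneEquivRelNormOne L).symm t₀),
          CMCenter L (lineVec L (a 1)) ((cmAdelicOneEquivRelNormOne L).symm t₁))) ∈ CMRat L a
  rw [← h₀, ← h₁]
  exact adelicIsometryConj_toAdelic_mem_range (↥(maximalRealSubfield L)) L (IsCMField.complexConj L) 1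
    (adelicIsometry_one_lineVec L a) 1 (ratIsometry_one_lineVec L a) (coe_one_GL_eq_map L (AdeleRing (𝓞 L) L) (Fin (1 + 1)))
    (adelicBlockDiag_toAdelic_mem_range (↥(maximalRealSubfield L)) L (IsCMField.complexConj L) 1 1 _ _ γ₀ γ₁)

/-- **principal norm-one idèles give RATIONAL points of the conjugated torus** `g₀ · diag(t₀, t₁) · g₀⁻¹ ∈ U(diag(a₀,a₁))(L⁺)`
(`g₀` rational). [cite: Mok2014, §1 Notation p. 5; PlatonovRapinchuk1994, §6.2] -/
theorem cmConjPlaneTorusIdeles_mem_CMRat {t₀ t₁ : ↥(relNormOneIdeles (↥(maximalRealSubfield L)) L)}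
    (ht₀ : t₀ ∈ relNormOneRat (↥(maximalRealSubfield L)) L) (ht₁ : t₁ ∈ relNormOneRat (↥(maximalRealSubfield L)) L) :
    cmConjPlaneTorusIdeles L a b g₀ hg₀ (t₀, t₁) ∈ CMRat L a := by
  obtain ⟨γ₀, h₀⟩ := cm_adelicCenter_symm_mem_range_toAdelic L 1 (Matrix.diagonal (lineVec L (b 0))) t₀ ht₀
  obtain ⟨γ₁, h₁⟩ := cm_adelicCenter_symm_mem_range_toAdelic L 1 (Matrix.diagonal (lineVec L (b 1))) t₁ ht₁
  show adelicIsometryConj (↥(maximalRealSubfield L)) L (IsCMField.complexConj L) (1 + 1) (toAdeleGL L g₀)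
      (adelicIsometry_conj L a b g₀ hg₀)
      (adelicBlockDiag (↥(maximalRealSubfield L)) L (IsCMField.complexConj L) 1 1 (Matrix.diagonal (lineVec L (b 0)))
        (Matrix.diagonal (lineVec L (b 1)))
        (CMCenter L (lineVec L (b 0)) ((cmAdelicOneEquivRelNormOne L).symm t₀),
          CMCenter L (lineVec L (b 1)) ((cmAdelicOneEquivRelNormOne L).symm t₁))) ∈ CMRat L a
  rw [← h₀, ← h₁]
  exact adelicIsometryConj_toAdelic_mem_range (↥(maximalRealSubfield L)) L (IsCMField.complexConj L) (toAdeleGL L g₀)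
    (adelicIsometry_conj L a b g₀ hg₀) g₀ (ratIsometry_conj L a b g₀ hg₀) (val_toAdeleGL L g₀)
    (adelicBlockDiag_toAdelic_mem_range (↥(maximalRealSubfield L)) L (IsCMField.complexConj L) 1 1 _ _ γ₀ γ₁)

variable (η : CMAdelic L dV × CMAdelic L a →* ℂˣ)
  (hη : ∀ γU ∈ CMRat L dV, ∀ γ ∈ CMRat L a, η (γU, γ) = 1)

include hη in
/-- **the DEFAULT first-line character `η₀ := cmEta₀ η` is trivial at rational points** when `η` is (the W-block's own binder `hη`).
[cite: GelbartRogawski1991, §3.1 Remark p. 457 L4–13] -/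
theorem cmEta₀_eq_one_of_rat {v : CMAdelic L dV} (hv : v ∈ CMRat L dV)
    {t : ↥(relNormOneIdeles (↥(maximalRealSubfield L)) L)} (ht : t ∈ relNormOneRat (↥(maximalRealSubfield L)) L) :
    cmEta₀ L dV a η (v, (cmAdelicOneEquivRelNormOne L).symm t) = 1 := by
  have h := hη v hv _ (cmPlaneTorusIdeles_mem_CMRat L a ht (one_mem _))
  rw [cmPlaneTorusIdeles_apply, map_one] at h
  exact h

include hη in
/-- **the DEFAULT second-line character `η₁ := cmEta₁ η` is trivial at rational points** when `η` is.
[cite: GelbartRogawski1991, §3.1 Remark p. 457 L4–13] -/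
theorem cmEta₁_eq_one_of_rat {t : ↥(relNormOneIdeles (↥(maximalRealSubfield L)) L)}
    (ht : t ∈ relNormOneRat (↥(maximalRealSubfield L)) L) :
    cmEta₁ L dV a η ((cmAdelicOneEquivRelNormOne L).symm t) = 1 := by
  have h := hη 1 (one_mem _) _ (cmPlaneTorusIdeles_mem_CMRat L a (one_mem _) ht)
  rw [cmPlaneTorusIdeles_apply, map_one] at h
  exact h

include hη in
/-- the DEFAULT conjugated first-line character `cmConjEta₀ η` is trivial at rational points when `η` is.
[cite: GelbartRogawski1991, §3.1 Remark p. 457 L4–13] -/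
theorem cmConjEta₀_eq_one_of_rat {v : CMAdelic L dV} (hv : v ∈ CMRat L dV)
    {t : ↥(relNormOneIdeles (↥(maximalRealSubfield L)) L)} (ht : t ∈ relNormOneRat (↥(maximalRealSubfield L)) L) :
    cmConjEta₀ L dV a b g₀ hg₀ η (v, (cmAdelicOneEquivRelNormOne L).symm t) = 1 := by
  have h := hη v hv _ (cmConjPlaneTorusIdeles_mem_CMRat L a b g₀ hg₀ ht (one_mem _))
  rw [cmConjPlaneTorusIdeles_apply, map_one] at h
  exact h

include hη in
/-- the DEFAULT conjugated second-line character `cmConjEta₁ η` is trivial at rational points when `η` is.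
[cite: GelbartRogawski1991, §3.1 Remark p. 457 L4–13] -/
theorem cmConjEta₁_eq_one_of_rat {t : ↥(relNormOneIdeles (↥(maximalRealSubfield L)) L)}
    (ht : t ∈ relNormOneRat (↥(maximalRealSubfield L)) L) :
    cmConjEta₁ L dV a b g₀ hg₀ η ((cmAdelicOneEquivRelNormOne L).symm t) = 1 := by
  have h := hη 1 (one_mem _) _ (cmConjPlaneTorusIdeles_mem_CMRat L a b g₀ hg₀ (one_mem _) ht)
  rw [cmConjPlaneTorusIdeles_apply, map_one] at h
  exact h

end DefaultSplit

/-! ### Build-lane note (ops-buildfix G11b-3 recipe, LEDGER B13-1, 2026-08-21)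
`lean -o` (the hub build lane, never `lean`/the gate check) runs Lean 4.32's library-suggestion indexers
(`Lean.LibrarySuggestions.SymbolFrequency` / `SineQuaNon`, from their `exportEntriesFn`) over the statement of
every local theorem that is not a denied premise; on this family's statements (very large dependent binder
telescopes through the theta-kernel / dual-pair data) that fold runs for tens of minutes to hours and the build
lane kills the job (incident G11b-3, run/shared/lean/ops/buildfix/G11b-3-DOSSIER.md). `isDeniedPremise` skips
`[implicit_reducible]` constants before any fold, and a reducibility status on a *theorem* is inert (Meta never
unfolds `thmInfo`; the kernel ignores the attribute), so the public theorems of this file are tagged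
`[implicit_reducible]` purely to keep them out of that index. Only other effect: they are not offered by
`+suggestions` premise selectors. No statement or proof is changed; superseded if the operator lands a
deny-list form (`HarnessLib.PremiseIndex`). -/
set_option allowUnsafeReducibility true in
attribute [implicit_reducible]
  cmLineRep₀_mem_thetaStabilizerEnd cmLineRep₁_mem_thetaStabilizerEnd
  cmLineRepFin₀_mem_thetaStabilizerEnd cmLineRepFin₁_mem_thetaStabilizerEnd
  forall_cmLineRepFin₀_mem_thetaStabilizerEnd forall_cmLineRepFin₁_mem_thetaStabilizerEnd
  cmConjLineRep₀_mem_thetaStabilizerEnd cmConjLineRep₁_mem_thetaStabilizerEnd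
  cmConjLineRepFin₀_mem_thetaStabilizerEnd cmConjLineRepFin₁_mem_thetaStabilizerEnd
  forall_cmConjLineRepFin₀_mem_thetaStabilizerEnd forall_cmConjLineRepFin₁_mem_thetaStabilizerEnd
  cmPlaneTorusIdeles_mem_CMRat cmConjPlaneTorusIdeles_mem_CMRat cmEta₀_eq_one_of_rat
  cmEta₁_eq_one_of_rat cmConjEta₀_eq_one_of_rat cmConjEta₁_eq_one_of_rat

end UnitaryDualPair

end Literature.NumberTheory.GelbartRogawski1991

end
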